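import Mathlib
import Literature.Geometry.Lorentzian.ReggeWheelerChannels
import Literature.Geometry.Lorentzian.ReggeWheelerTortoise
import Literature.Analysis.ODE.SchrodingerODE
import Summits.FinalStateConjecture.FinalStateConjecture.Theorems.PhotonSphereChannelsTortoiseFar
import Summits.FinalStateConjecture.FinalStateConjecture.Theorems.PhotonSphereChannelsUniformPhotonSphereChannelsRLadderExistsSeed
import Summits.FinalStateConjecture.FinalStateConjecture.Theorems.PhotonSphereChannelsUniformPhotonSphereChannelsRLadderExistsChain

/-!
# Crux `UniformPhotonSphereChannelsR` (K1R, stmt-FinalStateConjecture-14074), line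
# `crum-peeling-recessive-tower` — stub E: the recessive Riccati/Crum ladder exists (`stub_ladderExists`)

The registered stub `stub_ladderExists` of the line's skeleton, with `ρ₁ = C₁ = 0`: along every
tortoise radius function (`IsTortoiseRadius M r xc`), for `s ≤ 2`, `s ≤ ℓ` and EVERY `ρ ≥ 0`, the
Regge–Wheeler potential `V = linePotential M s ℓ r` carries superpotentials `W 0, …, W (ℓ−1)` and
partner potentials `U 0 = V, …, U ℓ` on `(xc + ρ − 1, ∞)` with `W_k' = U_k − W_k²`,
`U_{k+1} = 2 W_k² − U_k`, the recessive normalisation `x W_k → k − ℓ`, and `U ℓ ∈ C¹`.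

The ladder is in fact GLOBAL (no log edge is needed for existence): with the dominant zero-free seed
`v` of `v'' = V v` (`x v'/v → ℓ + 1`; `…RLadderExistsSeed`: `V ≥ 0`, `x² V → ℓ(ℓ+1)`), the
recessive seeds `u₀ = v ∫v⁻²`, `u_{k+1} = u_k⁻¹ ∫ u_k²` never vanish and `x u_k'/u_k → k − ℓ`
(`…RLadderExistsChain`, reduction of order + Darboux inversion); `W_k = u_k'/u_k`.
This file supplies the two facts about `V` (`ladder_of_potential` for an abstract `C¹` potential;
the private `tendsto_xsq_linePotential`: `x² V_{s,ℓ}(r(x)) → ℓ(ℓ+1)` from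
`r(x) = x + O(M log x)`, `Theorems.tortoise_far_asymptotics`) and assembles the stub; `ℓ = 0` has
no rung (`U 0 = V`).
-/

-- `Summit.<S>.<S>` repeats a namespace component by design (D-0017); off here as in the lakefile.
set_option linter.dupNamespace false

namespace Summit.FinalStateConjecture.FinalStateConjecture.Theorems.CrumPeelingRecessiveTower

open Literature.Geometry.Lorentzian Literature.Geometry.Lorentzian.ReggeWheeler MeasureTheory Filter
  Set Topology
open Literature.Analysis.ODE
open scoped ENNReal

/-! ### The ladder of an abstract potential -/

/-- **Recessive ladder of an abstract potential.** Let `V ∈ C¹`, `V ≥ 0`, `x² V(x) → ℓ(ℓ+1)` with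
`ℓ ≥ 1`.  Then for every `a` there are `W U : ℕ → ℝ → ℝ` with `U 0 = V`, `W_k' = U_k − W_k²`,
`U_{k+1} = 2W_k² − U_k`, `x W_k(x) → k − ℓ` (`k < ℓ`) and `U ℓ ∈ C¹` on `(a, ∞)` — the clauses of
`stub_ladderExists`.  (`W_k = u_k'/u_k` for the recessive chain of `chain_exists` started at the
dominant seed of `exists_dominant_seed`; everything is global.) [folklore] -/
theorem ladder_of_potential {V : ℝ → ℝ} (hV : ContDiff ℝ 1 V) (hV0 : ∀ x, 0 ≤ V x) {ℓ : ℕ}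
    (hℓ : 1 ≤ ℓ) (hlim : Tendsto (fun x => x ^ 2 * V x) atTop (𝓝 ((ℓ : ℝ) * ((ℓ : ℝ) + 1))))
    (a : ℝ) :
    ∃ (W U : ℕ → ℝ → ℝ),
      (∀ x, a < x → U 0 x = V x) ∧
      (∀ k, k < ℓ → ∀ x, a < x → HasDerivAt (W k) (U k x - W k x ^ 2) x) ∧
      (∀ k, k < ℓ → ∀ x, a < x → U (k + 1) x = 2 * W k x ^ 2 - U k x) ∧
      (∀ k, k < ℓ → Tendsto (fun x => x * W k x) atTop (𝓝 ((k : ℝ) - ℓ))) ∧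
      ContDiffOn ℝ 1 (U ℓ) (Set.Ioi a) := by
  have hα : (1 : ℝ) < (ℓ : ℝ) + 1 := by
    have : (1 : ℝ) ≤ ℓ := by exact_mod_cast hℓ
    linarith
  have hlim' : Tendsto (fun x => x ^ 2 * V x) atTop
      (𝓝 (((ℓ : ℝ) + 1) * ((ℓ : ℝ) + 1 - 1))) := by
    rw [show ((ℓ : ℝ) + 1) * ((ℓ : ℝ) + 1 - 1) = (ℓ : ℝ) * ((ℓ : ℝ) + 1) by ring]
    exact hlim
  obtain ⟨v, hv, hv0, hvlim⟩ := exists_dominant_seed hV.continuous hV0 hα hlim'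
  obtain ⟨u, U, hU0, hUS, hP⟩ := chain_exists hV hv hv0 hvlim
  have hW : ∀ k, k < ℓ → ∀ x, HasDerivAt (fun x => deriv (u k) x / u k x)
      (U k x - (deriv (u k) x / u k x) ^ 2) x := by
    intro k hk x
    obtain ⟨hsol, hne, -, -⟩ := hP k hk.le
    refine ((hsol.hasDerivAt_deriv x).fun_div (hsol.hasDerivAt x) (hne x)).congr_deriv ?_
    have := hne x
    field_simp
  refine ⟨fun k x => deriv (u k) x / u k x, U, fun x _ => by rw [hU0], fun k hk x _ => hW k hk x,
    fun k _ x _ => ?_, fun k hk => (hP k hk.le).2.2.1, (hP ℓ le_rfl).2.2.2.contDiffOn⟩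
  show U (k + 1) x = 2 * (deriv (u k) x / u k x) ^ 2 - U k x
  rw [hUS k]

/-! ### The Regge–Wheeler potential on the tortoise line -/

/-- `r(x)/x → 1` along a tortoise radius function (`x − xc + 3M − 6M log(1 + (x−xc)/9M) ≤ r x ≤
x − xc + 3M`, `Theorems.tortoise_far_asymptotics`).  Private copy of a fact also landed by the
line's peel worker (`tendsto_radius_div`, `…RPeelLadder.lean`). [folklore] -/
private theorem tendsto_tortoise_div {M : ℝ} {r : ℝ → ℝ} {xc : ℝ} (hr : IsTortoiseRadius M r xc) :
    Tendsto (fun x => r x / x) atTop (𝓝 1) := by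
  have hM := hr.mass_pos
  have hup : Tendsto (fun x => (x - xc + 3 * M) / x) atTop (𝓝 1) := by
    have h1 : Tendsto (fun x : ℝ => 1 + (3 * M - xc) / x) atTop (𝓝 (1 + 0)) :=
      tendsto_const_nhds.add (tendsto_const_nhds.div_atTop tendsto_id)
    rw [add_zero] at h1
    refine h1.congr' ?_
    filter_upwards [eventually_gt_atTop (0 : ℝ)] with x hx
    field_simp
    ring
  have hlog : Tendsto (fun x => 6 * M * Real.log (1 + (x - xc) / (9 * M)) / x) atTop (𝓝 0) := by
    have h1 := Real.tendsto_pow_log_div_mul_add_atTop (9 * M) (xc - 9 * M) 1 (by positivity)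
    have hy : Tendsto (fun x => 1 + (x - xc) / (9 * M)) atTop atTop := by
      refine tendsto_atTop_atTop.2 fun b => ⟨xc + 9 * M * b, fun x hx => ?_⟩
      have : b ≤ (x - xc) / (9 * M) := by
        rw [le_div_iff₀ (by positivity)]
        linarith
      linarith
    have h3 := (h1.comp hy).const_mul (6 * M)
    rw [mul_zero] at h3
    refine h3.congr' ?_
    filter_upwards [eventually_gt_atTop (0 : ℝ)] with x hx
    simp only [Function.comp_def, pow_one]
    have e : 9 * M * (1 + (x - xc) / (9 * M)) + (xc - 9 * M) = x := by
      field_simp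
      ring
    rw [e, mul_div_assoc]
  have hlow : Tendsto (fun x => (x - xc + 3 * M - 6 * M * Real.log (1 + (x - xc) / (9 * M))) / x)
      atTop (𝓝 1) := by
    have h := hup.sub hlog
    rw [sub_zero] at h
    refine h.congr' ?_
    refine Eventually.of_forall fun x => ?_
    ring
  refine tendsto_of_tendsto_of_tendsto_of_le_of_le' hlow hup ?_ ?_
  · filter_upwards [eventually_ge_atTop xc, eventually_gt_atTop (0 : ℝ)] with x hx hx0
    obtain ⟨-, h2⟩ := tortoise_far_asymptotics hM hr.two_mul_lt hr.hasDerivAt hr.center hx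
    exact div_le_div_of_nonneg_right (by linarith) hx0.le
  · filter_upwards [eventually_ge_atTop xc, eventually_gt_atTop (0 : ℝ)] with x hx hx0
    exact div_le_div_of_nonneg_right
      (tortoise_le_add hM hr.two_mul_lt hr.hasDerivAt hr.center hx) hx0.le

/-- **Far limit of the rescaled potential**: `x² V_{s,ℓ}(r(x)) → ℓ(ℓ+1)` as `x → +∞` along a
tortoise radius function (`r/x → 1`, `r → ∞`).  Private copy of the synonymous fact landed by the
line's peel worker in `…RPeelLadder.lean` (kept local to avoid a heavier import). [folklore] -/
private theorem tendsto_xsq_linePotential {M : ℝ} {r : ℝ → ℝ} {xc : ℝ} (hr : IsTortoiseRadius M r xc)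
    (s ℓ : ℕ) :
    Tendsto (fun x => x ^ 2 * linePotential M s ℓ r x) atTop (𝓝 ((ℓ : ℝ) * ((ℓ : ℝ) + 1))) := by
  have hr0 : ∀ x, 0 < r x := hr.pos
  -- `x / r x → 1`
  have hratio : Tendsto (fun x => x / r x) atTop (𝓝 1) := by
    have h := (tendsto_tortoise_div hr).inv₀ one_ne_zero
    rw [inv_one] at h
    exact h.congr fun x => inv_div (r x) x
  -- `1/r → 0`
  have hinv : Tendsto (fun x => (r x)⁻¹) atTop (𝓝 0) := hr.tendsto_atTop.inv_tendsto_atTop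
  have h1 : Tendsto (fun x => 1 - 2 * M * (r x)⁻¹) atTop (𝓝 (1 - 2 * M * 0)) :=
    tendsto_const_nhds.sub (hinv.const_mul _)
  have h2 : Tendsto (fun x => (ℓ : ℝ) * ((ℓ : ℝ) + 1) + (1 - (s : ℝ) ^ 2) * (2 * M) * (r x)⁻¹)
      atTop (𝓝 ((ℓ : ℝ) * ((ℓ : ℝ) + 1) + (1 - (s : ℝ) ^ 2) * (2 * M) * 0)) :=
    tendsto_const_nhds.add (hinv.const_mul _)
  have h3 := (h1.mul (hratio.pow 2)).mul h2
  simp only [mul_zero, sub_zero, add_zero, one_pow, one_mul] at h3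
  refine h3.congr fun x => ?_
  simp only [linePotential_apply, rwPotential]
  have := (hr0 x).ne'
  field_simp

/-! ### The stub -/

/-- **Stub E — the recessive Riccati ladder exists on a neighbourhood of the far half-line**
(registered stub `stub_ladderExists` of line `crum-peeling-recessive-tower`, crux K1R), with
`ρ₁ = C₁ = 0`: for every tortoise radius function, `s ≤ 2`, `s ≤ ℓ` and `ρ ≥ 0` there are
superpotentials `W 0, …, W (ℓ−1)` and partner potentials `U 0 = V_{s,ℓ}, …, U ℓ` on
`(xc + ρ − 1, ∞)` with `W_k' + W_k² = U_k`, `U_{k+1} = 2 W_k² − U_k`, `x W_k(x) → −(ℓ − k)`, and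
`U ℓ ∈ C¹` there.  The ladder is global: the recessive chain obtained from the dominant seed by
reduction of order never vanishes (`ladder_of_potential`); `ℓ = 0` has no rung. [folklore] -/
theorem stub_ladderExists :
    ∀ M : ℝ, 0 < M → ∃ ρ₁ : ℝ, 0 ≤ ρ₁ ∧ ∃ C₁ : ℝ, 0 ≤ C₁ ∧
      ∀ (r : ℝ → ℝ) (xc : ℝ), IsTortoiseRadius M r xc → ∀ (s ℓ : ℕ), s ≤ 2 → s ≤ ℓ →
        ∀ ρ : ℝ, ρ₁ + C₁ * Real.log ((ℓ : ℝ) + 1) ≤ ρ →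
          ∃ (W U : ℕ → ℝ → ℝ) (a : ℝ), a < xc + ρ ∧
            (∀ x, a < x → U 0 x = linePotential M s ℓ r x) ∧
            (∀ k, k < ℓ → ∀ x, a < x → HasDerivAt (W k) (U k x - W k x ^ 2) x) ∧
            (∀ k, k < ℓ → ∀ x, a < x → U (k + 1) x = 2 * W k x ^ 2 - U k x) ∧
            (∀ k, k < ℓ → Tendsto (fun x => x * W k x) atTop (𝓝 ((k : ℝ) - ℓ))) ∧
            ContDiffOn ℝ 1 (U ℓ) (Set.Ioi a) := by
  intro M _
  refine ⟨0, le_rfl, 0, le_rfl, ?_⟩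
  intro r xc hr s ℓ _ hsℓ ρ _
  -- `V` is `C¹` (as in `Theorems.CauchyWave.contDiff_one_linePotential`; `r ∈ C¹`, `r > 0`)
  have hV : ContDiff ℝ 1 (linePotential M s ℓ r) := by
    have hrC : ContDiff ℝ 1 r := hr.contDiff_one
    have hr0 : ∀ x, r x ≠ 0 := fun x => (hr.pos x).ne'
    unfold linePotential rwPotential
    exact (contDiff_const.sub (contDiff_const.div hrC hr0)).mul
      ((contDiff_const.div (hrC.pow 2) fun x ↦ pow_ne_zero _ (hr0 x)).add
        (contDiff_const.div (hrC.pow 3) fun x ↦ pow_ne_zero _ (hr0 x)))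
  rcases Nat.eq_zero_or_pos ℓ with hℓ | hℓ
  · -- no rung: `U 0 = V`
    subst hℓ
    refine ⟨fun _ _ => 0, fun _ => linePotential M s 0 r, xc + ρ - 1, by linarith,
      fun x _ => rfl, fun k hk => absurd hk (Nat.not_lt_zero k),
      fun k hk => absurd hk (Nat.not_lt_zero k), fun k hk => absurd hk (Nat.not_lt_zero k),
      hV.contDiffOn⟩
  · obtain ⟨W, U, h0, h1, h2, h3, h4⟩ := ladder_of_potential hV
      (linePotential_nonneg hr.mass_pos.le hsℓ hr.two_mul_lt) hℓ
      (tendsto_xsq_linePotential hr s ℓ) (xc + ρ - 1)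
    exact ⟨W, U, xc + ρ - 1, by linarith, h0, h1, h2, h3, h4⟩

end Summit.FinalStateConjecture.FinalStateConjecture.Theorems.CrumPeelingRecessiveTower
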